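import Summits.ResolutionOfSingularities.ResolutionOfSingularities.Theorems.FrobeniusLadderFRationalResolutionVertexChartRegularity
import Summits.ResolutionOfSingularities.ResolutionOfSingularities.Theorems.FrobeniusLadderFRationalResolutionFixedStratumSingular
import Summits.ResolutionOfSingularities.ResolutionOfSingularities.Theorems.FrobeniusLadderFRationalResolutionFixedStratumGenericPoint
import HarnessLib

/-!
# Crux `FrobeniusLadder.FRationalResolution` (stmt-ResolutionOfSingularities-15317), line `redirect`,
# stub `stub_diagonalizableQuotientResolution` — **the vertex chart algebra is singular at EVERY point of its
# torus-fixed stratum (`c ≥ 2`), over a log stratum of ANY dimension** (design C3 = the rank-2 stratum layer of the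
# non-isolated case, memo MEMO-15317-leafhand2-g10 §2 (L2): the positive-dimensional-stratum version of
# `…VertexChartRegularity.not_isRegularLocalRing_fixedPrime_of_two_le`, whose hypotheses `h0` (zero-dimensional
# stratum) and `hdimA` (`dim A_𝔭 ≤ 2`) are REPLACED by log regularity along the stratum and the rank bound
# `n − rk F_𝔭 ≤ 2`)

Proof: at the generic point `η = I(𝔭)A_𝔭 ∩ A` of the stratum (`…FixedStratumGenericPoint`) the hypotheses `h0` and
`hdimA` hold, so the surface test applies to the fixed prime over `η`; that prime lies inside `𝔓`
(`…FixedStratumChains`) and singularity propagates up (`…FixedStratumSingular`, Serre).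
* **`not_isRegularLocalRing_fixedPrime_of_two_le_of_stratum`**.

Honest label: generic local algebra toward ONE leaf stub (no stub, crux or summit closed). No definitions, no named
facts, no sorry. [cite: Kato1994, (6.1), (7.3), (10.1)] [cite: Matsumura1987, Thm. 19.3]
-/

noncomputable section

-- single-problem summit: the doubled namespace component is forced
set_option linter.dupNamespace false

open IsLocalRing Literature.AlgebraicGeometry.Resolution Literature.AlgebraicGeometry.Resolution.LogChart
open Summit.ResolutionOfSingularities.ResolutionOfSingularities.Theorems.FRationalResolution.VertexChartMonoid
open Summit.ResolutionOfSingularities.ResolutionOfSingularities.Theorems.FRationalResolution.VertexChartRegularity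
open Summit.ResolutionOfSingularities.ResolutionOfSingularities.Theorems.FRationalResolution.FixedStratumChains
open Summit.ResolutionOfSingularities.ResolutionOfSingularities.Theorems.FRationalResolution.FixedStratumSingular
open Summit.ResolutionOfSingularities.ResolutionOfSingularities.Theorems.FRationalResolution.FixedStratumGenericPoint

namespace Summit.ResolutionOfSingularities.ResolutionOfSingularities.Theorems.FRationalResolution.FixedStratumVertexSingular

universe u

variable {A : Type u} [CommRing A] [IsNoetherianRing A] {n : ℕ} {P : AddSubmonoid (Fin n → ℤ)}
  {φ : Multiplicative P →* A} {𝔭 : Ideal A} [𝔭.IsPrime] {C : Type u} [CommRing C] [Algebra A C]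
  {Q : AddSubmonoid (Fin n → ℤ)} {χ : Multiplicative Q →* C} {v x : Fin n → ℤ} {c : ℕ}

/-- **The vertex chart algebra is singular along its whole fixed stratum (`c ≥ 2`).** Let `φ : P → A` be log regular
at `𝔭` and at every prime `𝔮 ⊆ 𝔭` containing `I(𝔭, φ)`, with `n − rk F_𝔭 ≤ 2`; let `C = A[χ(Q)]` be a chart algebra
((D), (K)) whose monoid is the vertex cone `Q = ℤF_𝔭 + {m v + l x : m ≥ 0, m + c l ≥ 0}` with `c ≥ 2`; and let `𝔓`
be a prime of `C` over `𝔭` containing `χ(Q ∖ ℤF_𝔭)`. Then `C_𝔓` is not a regular local ring.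
[cite: Kato1994, (6.1), (7.3), (10.1)] [cite: Matsumura1987, Thm. 19.3] -/
theorem not_isRegularLocalRing_fixedPrime_of_two_le_of_stratum [IsNoetherianRing C] (hc : 2 ≤ c) (hP : P.FG)
    (hsat : ∀ (w : Fin n → ℤ) (k : ℕ), 0 < k → k • w ∈ P → w ∈ P) (hreg : IsLogRegularAt P φ 𝔭)
    (hreg' : ∀ (𝔮 : Ideal A) [𝔮.IsPrime], 𝔮 ≤ 𝔭 → ideal P φ 𝔭 ≤ 𝔮 → IsLogRegularAt P φ 𝔮)
    (hrank : n - Module.finrank ℤ (Submodule.span ℤ (faceMonoid P φ 𝔭 : Set (Fin n → ℤ))) ≤ 2)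
    (hPQ : P ≤ Q)
    (hχ : ∀ p : P, χ (Multiplicative.ofAdd ⟨(p : Fin n → ℤ), hPQ p.2⟩) =
      algebraMap A C (φ (Multiplicative.ofAdd p)))
    (hgen : Algebra.adjoin A (Set.range χ) = ⊤)
    (hD : ∀ q ∈ Q, ∃ p ∈ P, q + p ∈ P)
    (hK : ∀ a : A, algebraMap A C a = 0 → ∃ p : P, φ (Multiplicative.ofAdd p) * a = 0)
    (hQfg : Q.FG)
    (hQ : ∀ w, w ∈ Q ↔ ∃ g ∈ Submodule.span ℤ (faceMonoid P φ 𝔭 : Set (Fin n → ℤ)), ∃ m l : ℤ,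
      0 ≤ m ∧ 0 ≤ m + (c : ℤ) * l ∧ w = g + m • v + l • x)
    (hind : ∀ g ∈ Submodule.span ℤ (faceMonoid P φ 𝔭 : Set (Fin n → ℤ)), ∀ m l : ℤ,
      g + m • v + l • x = 0 → m = 0 ∧ l = 0)
    (hspan : ∀ w : Fin n → ℤ, ∃ g ∈ Submodule.span ℤ (faceMonoid P φ 𝔭 : Set (Fin n → ℤ)),
      ∃ m l : ℤ, w = g + m • v + l • x)
    {𝔓 : Ideal C} [𝔓.IsPrime] (h𝔓 : 𝔓.comap (algebraMap A C) = 𝔭)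
    (hq : ∀ q : Q, (q : Fin n → ℤ) ∉ Submodule.span ℤ (faceMonoid P φ 𝔭 : Set (Fin n → ℤ)) →
      χ (Multiplicative.ofAdd q) ∈ 𝔓) :
    ¬ IsRegularLocalRing (Localization.AtPrime 𝔓) := by
  -- the generic point `η` of the stratum of `𝔭`
  haveI hI'p := isPrime_map_ideal_of_isLogRegularAt (P := P) (φ := φ) (𝔭 := 𝔭) hreg
  have hne : (ideal P φ 𝔭).map (algebraMap A (Localization.AtPrime 𝔭)) ≠ ⊤ := hI'p.ne_top
  set η : Ideal A := ((ideal P φ 𝔭).map (algebraMap A (Localization.AtPrime 𝔭))).comap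
    (algebraMap A (Localization.AtPrime 𝔭)) with hη
  haveI : η.IsPrime := Ideal.IsPrime.comap _
  have hle : η ≤ 𝔭 := comap_map_ideal_le hne
  have hIη : ideal P φ 𝔭 ≤ η := ideal_le_comap_map_ideal
  have hregη : IsLogRegularAt P φ η := hreg' η hle hIη
  have hF : faceMonoid P φ η = faceMonoid P φ 𝔭 := faceMonoid_eq_of_le_of_ideal_le hle hIη
  -- `h0` and `hdimA` at `η`
  have h0η : maximalIdeal (Localization.AtPrime η) ≤
      (ideal P φ η).map (algebraMap A (Localization.AtPrime η)) :=
    maximalIdeal_le_map_ideal_genericPoint hne hη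
  have himg : (fun p : P => (p : Fin n → ℤ)) '' face P φ η = (faceMonoid P φ 𝔭 : Set (Fin n → ℤ)) := by
    rw [← hF]
    ext w
    simp only [Set.mem_image, mem_face_iff, SetLike.mem_coe, mem_faceMonoid]
    constructor
    · rintro ⟨p, hp, rfl⟩
      exact ⟨p.2, by rw [val_of_mem P φ p.2]; exact hp⟩
    · rintro ⟨hw, hw'⟩
      exact ⟨⟨w, hw⟩, by rw [val_of_mem P φ hw] at hw'; exact hw', rfl⟩
  have hdimη : ringKrullDim (Localization.AtPrime η) ≤ (2 : ℕ) := by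
    rw [ringKrullDim_genericPoint hne hη hregη]
    have hfin : Module.finrank ℤ (Submodule.span ℤ ((fun p : P => (p : Fin n → ℤ)) '' face P φ η)) =
        Module.finrank ℤ (Submodule.span ℤ (faceMonoid P φ 𝔭 : Set (Fin n → ℤ))) := by
      rw [himg]
    rw [hfin]
    exact_mod_cast hrank
  -- (S), (H) for the vertex cone
  have hS : ∀ q₁ ∈ Q, ∀ q₂ ∈ Q, q₁ + q₂ ∈ Submodule.span ℤ (faceMonoid P φ 𝔭 : Set (Fin n → ℤ)) →
      q₁ ∈ Submodule.span ℤ (faceMonoid P φ 𝔭 : Set (Fin n → ℤ)) := vertex_face (by omega) hQ hind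
  have hH : ∀ q ∈ Q, ∀ p ∈ P, q + p ∈ Submodule.span ℤ (faceMonoid P φ 𝔭 : Set (Fin n → ℤ)) →
      q ∈ Submodule.span ℤ (faceMonoid P φ 𝔭 : Set (Fin n → ℤ)) :=
    fun q hq' p hp hqp => hS q hq' p (hPQ hp) hqp
  -- the surface test at the fixed prime over `η`, carried up to `𝔓`
  refine not_isRegularLocalRing_fixedPrime_of_stratum hP hsat hle hIη hregη hPQ hχ hgen hD hK hS hH h𝔓 hq
    fun 𝔓₁ _ h𝔓₁A h𝔓₁q => ?_
  have hQ' : ∀ w, w ∈ Q ↔ ∃ g ∈ Submodule.span ℤ (faceMonoid P φ η : Set (Fin n → ℤ)), ∃ m l : ℤ,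
      0 ≤ m ∧ 0 ≤ m + (c : ℤ) * l ∧ w = g + m • v + l • x := by rw [hF]; exact hQ
  have hind' : ∀ g ∈ Submodule.span ℤ (faceMonoid P φ η : Set (Fin n → ℤ)), ∀ m l : ℤ,
      g + m • v + l • x = 0 → m = 0 ∧ l = 0 := by rw [hF]; exact hind
  have hspan' : ∀ w : Fin n → ℤ, ∃ g ∈ Submodule.span ℤ (faceMonoid P φ η : Set (Fin n → ℤ)),
      ∃ m l : ℤ, w = g + m • v + l • x := by rw [hF]; exact hspan
  have hq' : ∀ q : Q, (q : Fin n → ℤ) ∉ Submodule.span ℤ (faceMonoid P φ η : Set (Fin n → ℤ)) →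
      χ (Multiplicative.ofAdd q) ∈ 𝔓₁ := by rw [hF]; exact h𝔓₁q
  exact not_isRegularLocalRing_fixedPrime_of_two_le hc hP hsat hregη hPQ hχ hgen hD hK hQfg hQ' hind' hspan'
    h𝔓₁A hq' h0η hdimη

end Summit.ResolutionOfSingularities.ResolutionOfSingularities.Theorems.FRationalResolution.FixedStratumVertexSingular

end
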